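import Literature.NumberTheory.Automorphic.ArchLocalTorusOrbitalBlockSmoothParam   -- ★ p851244 (F0P3a-p09 (g7)) (P-SMOOTH): `exists_closedBall_isCompact_conj_circleDiagonal_angles_not_mem_of_blocks`, `contDiffOn_rootProduct_smul_integral_param_chamber_ball_swap`
import Literature.NumberTheory.Rogawski1990.ArchCentralJetBoundsAllFrames        -- ★ p851226 (F0P3a-p09 (g7)) (B3-ENGINE) §6 `exists_forall_norm_iteratedFDeriv_rootProduct_smul_orbital_comp_clm_le`, `isOpen_chamber`
import Literature.NumberTheory.Automorphic.ArchTorusOrbitalFubiniSmooth           -- ★ `isCompact_setOf_coe_archLocal_mem` (properness of `G_w ↪ M₃(ℂ)`)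
import Literature.Analysis.Calculus.ParametricFamilyLocalisation                  -- ★ (F0P3a-p04 (g24)): `exists_contDiff_uncurry_eventuallyEq_of_contDiffOn`, `fderiv_slice_fst_apply_of_prod`
import Literature.Analysis.Calculus.ParametricSliceJets                           -- ★ p851003 (F0P3a-p04 (g24)): `fderiv_integral_comp_of_contDiff_of_support_apply`, `hasFDerivAt_integral_comp_of_contDiff_of_support`
import HarnessLib

/-!
# The CENTRAL (rank-two, scalar-corner) block reader on an OPEN-SET family: `h1`, `h2` and the CLM-uniform `hunif` of ★ (E1)∕(E4′) at a scalar compact place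
# (Harish-Chandra's bounds at a central point; Varadarajan 1977 I §1.12, §3; Hörmander ALPDO I Thm. 1.1.9; Warner II Thm. 8.4.3.1)

Topic `NumberTheory/Automorphic`; namespace `Literature.NumberTheory.Automorphic.UnitaryGroup`.  THEOREMS ONLY (no `def`, no instance, no notation, no axiom, no named fact, no `sorry`);
kernel lane `--kind proof --supports stmt-HodgeConjecture-24833`.  Cell `pub/hodgecm-mathlib`, crux H413 (`stmt-HodgeConjecture-24833`), F0∕P3c line LH3 (leaf `F0_P3c_StubN9Direct` v5.1), organ
**O-L1d′ `stub_N9hcCentralMixedJetBounds`** (LH3-plan (g4) RULING #19: (hCm-ASM) → F0P3a-p08 (g23)); brick **(c-ii) «the central reader package»**.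

THE READER at the compact place `w` (local group `G_w = archLocal L 3 (diagonal α) w`, Haar `ν`, centre `ζ ∈ S¹`):
  `Φ_c F θ := (rootProduct θ : ℝ) • ∫_{G_w} F(↑↑(g · diag(ζ e^{iθ_k}) · g⁻¹)) dν(g)`      (`F : M₃(ℂ) → E`, `θ : Fin 3 → ℝ`)
written beta-reduced in every statement (no `def`).  The OPEN CHAMBER SET `T₂ := {θ | ∃ σ, θ_{σ0} < θ_{σ1} < θ_{σ2}} ∩ B(0, ½)`.  For families `Θ : Q → M₃(ℂ) → E` of the OPEN CLASS
«`ContDiffOn ℝ ∞ (uncurry Θ) (O ×ˢ univ)`, one compact MATRIX support `C` on `O`» (the `hread` class of ★ (E1) p851230 ∕ (E4′) and of ★ (X3-rk1) p851218):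
* §1 `fderiv_integral_comp_conj_circleDiagonal_param_apply` — GLOBAL class, `∂_v` INSIDE the integral at a regular angle (★ p851003 engine + ★ p851244 §1 uniform properness);
* §2 **`contDiffOn_centralReader_param_of_isOpen`** (`h1`: `(q, θ) ↦ Φ_c(Θ_q)(θ)` is `C^∞` on `O ×ˢ T₂` — ★ p851244 `…_chamber_ball_swap` per chamber + localisation ★ `exists_contDiff_uncurry_eventuallyEq_of_contDiffOn`),
  **`fderiv_centralReader_param_apply_of_mem_isOpen`**, **`fderiv_centralReader_param_prod_apply_of_isOpen`** (`h2`: `D[(q,θ) ↦ Φ_c(Θ_q)(θ)](x)·(v,0) = Φ_c(∂_vΘ_{x.1})(x.2)` on `O ×ˢ T₂`);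
* §3 **`exists_forall_norm_iteratedFDeriv_centralReader_comp_clm_le`** (`hunif`: for `G : M₃(ℂ) → E′` smooth with compact support ONE `B` with `‖Dⁿ[Φ_c(ℓ ∘ G)](θ)‖ ≤ ‖ℓ‖·B` for
  all `θ ∈ T₂ ∩ B(0, ¼)` and all CLMs `ℓ` — ★ p851226 §6 maxed over the six chambers; matrix support ⇒ group support by ★ `isCompact_setOf_coe_archLocal_mem`).
So the central block of the MIXED organ docks into ★ (E1)∕(E4′)∕(E5′) by `exact`, exactly as the face block docks by ★ p851216∕p851218.
HONEST LABEL: count-neutral; HC_CM is proved only modulo the 7 printed citations (2 remaining: hLiu418 = stmt-HodgeConjecture-24832, h413 = stmt-HodgeConjecture-24833) until rung 0 closes.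

## References
* [Varadarajan1977] V. S. Varadarajan, *Harmonic Analysis on Real Reductive Groups*, LNM 576 (1977), Part I §1.12, §3.
* [HormanderALPDO1] L. Hörmander, *The Analysis of Linear Partial Differential Operators I*, 2nd ed. (1990), Thm. 1.1.9, Thm. 1.4.1.
* [WarnerHASSLG2] G. Warner, *Harmonic Analysis on Semi-Simple Lie Groups II*, Springer (1972), Thm. 8.4.3.1.
* [Rogawski1990] J. D. Rogawski, *Automorphic Representations of Unitary Groups in Three Variables*, Ann. of Math. Stud. 123 (1990), §8.4 p. 126.
-/

set_option autoImplicit false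

noncomputable section

open MeasureTheory Measure Filter Topology Set Function Metric NumberField NumberField.InfinitePlace
open scoped ContDiff Matrix MatrixGroups Matrix.Norms.Operator ENNReal
open Literature.Analysis.Calculus Literature.Geometry.ComplexHyperbolic.BallModel Literature.NumberTheory.Rogawski1990

namespace Literature.NumberTheory.Automorphic

namespace UnitaryGroup

variable (L : Type) [Field L] (α : Fin 3 → L) (w : {w : InfinitePlace L // IsComplex w})
  [MeasurableSpace (archLocal L 3 (Matrix.diagonal α) w)] [BorelSpace (archLocal L 3 (Matrix.diagonal α) w)]
  {E : Type} [NormedAddCommGroup E] [NormedSpace ℝ E] [CompleteSpace E]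
  {Q : Type*} [NormedAddCommGroup Q] [NormedSpace ℝ Q] [FiniteDimensional ℝ Q]

/-! ## §1 Global class: `∂_v` inside the central orbital integral at a regular angle -/

omit [CompleteSpace E] in
/-- **`∂_v` INSIDE, GLOBAL CLASS**: for `Θ : Q → M₃(ℂ) → E` jointly `C^∞` with one compact matrix support and a REGULAR angle `θ` (`ζe^{iθ_i} ≠ ζe^{iθ_j}`, `i ≠ j`),
`∂_v [q ↦ ∫_{G_w} Θ_q(↑↑(g·diag(ζe^{iθ})·g⁻¹)) dν](q) = ∫_{G_w} (∂_v Θ)_q(↑↑(g·diag(ζe^{iθ})·g⁻¹)) dν` — ★ `fderiv_integral_comp_of_contDiff_of_support_apply` with the uniform compact `g`-support of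
★ `exists_closedBall_isCompact_conj_circleDiagonal_angles_not_mem_of_blocks` (singleton blocks). [cite: HormanderALPDO1, Thm. 1.1.9] [cite: Varadarajan1977, I §1.12] -/
theorem fderiv_integral_comp_conj_circleDiagonal_param_apply (hα : ∀ i, α i ≠ 0) (hreal : ∀ i, (w.1.embedding (α i)).im = 0)
    (ν : Measure (archLocal L 3 (Matrix.diagonal α) w)) [IsFiniteMeasureOnCompacts ν]
    (Θ : Q → Matrix (Fin 3) (Fin 3) ℂ → E) (hΘ : ContDiff ℝ ∞ (Function.uncurry Θ))
    {C : Set (Matrix (Fin 3) (Fin 3) ℂ)} (hC : IsCompact C) (h0 : ∀ (q : Q) (X : Matrix (Fin 3) (Fin 3) ℂ), X ∉ C → Θ q X = 0)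
    (ζ : Circle) {θ : Fin 3 → ℝ} (hθ : ∀ i j : Fin 3, i ≠ j → ζ * Circle.exp (θ i) ≠ ζ * Circle.exp (θ j)) (q : Q) (v : Q) :
    fderiv ℝ (fun q' : Q => ∫ g : archLocal L 3 (Matrix.diagonal α) w, Θ q' (((g * ⟨circleDiagonal 3 (fun k => ζ * Circle.exp (θ k)), circleDiagonal_mem_archLocal_diagonal L 3 α w _⟩ * g⁻¹ : archLocal L 3 (Matrix.diagonal α) w) : GL (Fin 3) ℂ) : Matrix (Fin 3) (Fin 3) ℂ) ∂ν) q v =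
      ∫ g : archLocal L 3 (Matrix.diagonal α) w, fderiv ℝ (fun q' : Q => Θ q' (((g * ⟨circleDiagonal 3 (fun k => ζ * Circle.exp (θ k)), circleDiagonal_mem_archLocal_diagonal L 3 α w _⟩ * g⁻¹ : archLocal L 3 (Matrix.diagonal α) w) : GL (Fin 3) ℂ) : Matrix (Fin 3) (Fin 3) ℂ)) q v ∂ν := by
  -- the jointly smooth integrand `Ψ ((A, B), q) = Θ q (A · diag · B)` and the continuous datum `y g = (↑↑g, ↑↑g⁻¹)`
  set Ψ : (Matrix (Fin 3) (Fin 3) ℂ × Matrix (Fin 3) (Fin 3) ℂ) × Q → E :=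
    fun p => Θ p.2 (p.1.1 * ((circleDiagonal 3 fun k => ζ * Circle.exp (θ k) : GL (Fin 3) ℂ) : Matrix (Fin 3) (Fin 3) ℂ) * p.1.2) with hΨ
  have hΨd : ContDiff ℝ ∞ Ψ :=
    hΘ.comp (contDiff_snd.prodMk (((contDiff_fst.comp contDiff_fst).mul contDiff_const).mul (contDiff_snd.comp contDiff_fst)))
  set y : archLocal L 3 (Matrix.diagonal α) w → Matrix (Fin 3) (Fin 3) ℂ × Matrix (Fin 3) (Fin 3) ℂ :=
    fun g => (((g : GL (Fin 3) ℂ) : Matrix (Fin 3) (Fin 3) ℂ), (((g⁻¹ : archLocal L 3 (Matrix.diagonal α) w) : GL (Fin 3) ℂ) : Matrix (Fin 3) (Fin 3) ℂ)) with hy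
  have hyc : Continuous y :=
    (Units.continuous_val.comp continuous_subtype_val).prodMk ((Units.continuous_val.comp continuous_subtype_val).comp continuous_inv)
  have hΨy : ∀ (g : archLocal L 3 (Matrix.diagonal α) w) (q' : Q), Ψ (y g, q') = Θ q' (((g * ⟨circleDiagonal 3 (fun k => ζ * Circle.exp (θ k)), circleDiagonal_mem_archLocal_diagonal L 3 α w _⟩ * g⁻¹ : archLocal L 3 (Matrix.diagonal α) w) : GL (Fin 3) ℂ) : Matrix (Fin 3) (Fin 3) ℂ) := fun g q' => by
    simp only [hΨ, hy, coe_conj_archLocal]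
  -- uniform compact `g`-support (the angle is regular: singleton blocks)
  have hCg : IsCompact {k : archLocal L 3 (Matrix.diagonal α) w | ((k : GL (Fin 3) ℂ) : Matrix (Fin 3) (Fin 3) ℂ) ∈ C} := isCompact_setOf_coe_archLocal_mem L 3 α w hα hC
  obtain ⟨δ, hδ, S, hS, hS0⟩ := exists_closedBall_isCompact_conj_circleDiagonal_angles_not_mem_of_blocks L 3 α w hα hreal (b := fun i : Fin 3 => i)
    (fun i j hij hb => absurd hb hij) hCg (fun _ => ζ) θ (fun i j hij => hθ i j hij)
  have key := fderiv_integral_comp_of_contDiff_of_support_apply ν Ψ hΨd y hyc q hS univ_mem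
    (fun g hg q' _ => by
      rw [hΨy]
      exact h0 q' _ (hS0 g hg θ (Metric.mem_closedBall_self hδ.le)))
    v
  simp only [hΨy] at key
  exact key

omit [CompleteSpace E] in
/-- **DIFFERENTIABILITY IN THE PARAMETER, GLOBAL CLASS** (same data as §1): `q ↦ ∫_{G_w} Θ_q(↑↑(g·diag(ζe^{iθ})·g⁻¹)) dν` is differentiable at every `q` (★ `hasFDerivAt_integral_comp_of_contDiff_of_support`).
[cite: HormanderALPDO1, Thm. 1.1.9] -/
theorem differentiableAt_integral_comp_conj_circleDiagonal_param (hα : ∀ i, α i ≠ 0) (hreal : ∀ i, (w.1.embedding (α i)).im = 0)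
    (ν : Measure (archLocal L 3 (Matrix.diagonal α) w)) [IsFiniteMeasureOnCompacts ν]
    (Θ : Q → Matrix (Fin 3) (Fin 3) ℂ → E) (hΘ : ContDiff ℝ ∞ (Function.uncurry Θ))
    {C : Set (Matrix (Fin 3) (Fin 3) ℂ)} (hC : IsCompact C) (h0 : ∀ (q : Q) (X : Matrix (Fin 3) (Fin 3) ℂ), X ∉ C → Θ q X = 0)
    (ζ : Circle) {θ : Fin 3 → ℝ} (hθ : ∀ i j : Fin 3, i ≠ j → ζ * Circle.exp (θ i) ≠ ζ * Circle.exp (θ j)) (q : Q) :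
    DifferentiableAt ℝ (fun q' : Q => ∫ g : archLocal L 3 (Matrix.diagonal α) w, Θ q' (((g * ⟨circleDiagonal 3 (fun k => ζ * Circle.exp (θ k)), circleDiagonal_mem_archLocal_diagonal L 3 α w _⟩ * g⁻¹ : archLocal L 3 (Matrix.diagonal α) w) : GL (Fin 3) ℂ) : Matrix (Fin 3) (Fin 3) ℂ) ∂ν) q := by
  set Ψ : (Matrix (Fin 3) (Fin 3) ℂ × Matrix (Fin 3) (Fin 3) ℂ) × Q → E :=
    fun p => Θ p.2 (p.1.1 * ((circleDiagonal 3 fun k => ζ * Circle.exp (θ k) : GL (Fin 3) ℂ) : Matrix (Fin 3) (Fin 3) ℂ) * p.1.2) with hΨ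
  have hΨd : ContDiff ℝ ∞ Ψ :=
    hΘ.comp (contDiff_snd.prodMk (((contDiff_fst.comp contDiff_fst).mul contDiff_const).mul (contDiff_snd.comp contDiff_fst)))
  set y : archLocal L 3 (Matrix.diagonal α) w → Matrix (Fin 3) (Fin 3) ℂ × Matrix (Fin 3) (Fin 3) ℂ :=
    fun g => (((g : GL (Fin 3) ℂ) : Matrix (Fin 3) (Fin 3) ℂ), (((g⁻¹ : archLocal L 3 (Matrix.diagonal α) w) : GL (Fin 3) ℂ) : Matrix (Fin 3) (Fin 3) ℂ)) with hy
  have hyc : Continuous y :=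
    (Units.continuous_val.comp continuous_subtype_val).prodMk ((Units.continuous_val.comp continuous_subtype_val).comp continuous_inv)
  have hΨy : ∀ (g : archLocal L 3 (Matrix.diagonal α) w) (q' : Q), Ψ (y g, q') = Θ q' (((g * ⟨circleDiagonal 3 (fun k => ζ * Circle.exp (θ k)), circleDiagonal_mem_archLocal_diagonal L 3 α w _⟩ * g⁻¹ : archLocal L 3 (Matrix.diagonal α) w) : GL (Fin 3) ℂ) : Matrix (Fin 3) (Fin 3) ℂ) := fun g q' => by
    simp only [hΨ, hy, coe_conj_archLocal]
  have hCg : IsCompact {k : archLocal L 3 (Matrix.diagonal α) w | ((k : GL (Fin 3) ℂ) : Matrix (Fin 3) (Fin 3) ℂ) ∈ C} := isCompact_setOf_coe_archLocal_mem L 3 α w hα hC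
  obtain ⟨δ, hδ, S, hS, hS0⟩ := exists_closedBall_isCompact_conj_circleDiagonal_angles_not_mem_of_blocks L 3 α w hα hreal (b := fun i : Fin 3 => i)
    (fun i j hij hb => absurd hb hij) hCg (fun _ => ζ) θ (fun i j hij => hθ i j hij)
  have key := (hasFDerivAt_integral_comp_of_contDiff_of_support ν Ψ hΨd y hyc q hS univ_mem
    (fun g hg q' _ => by
      rw [hΨy]
      exact h0 q' _ (hS0 g hg θ (Metric.mem_closedBall_self hδ.le)))).differentiableAt
  have hfun : (fun q' : Q => ∫ g : archLocal L 3 (Matrix.diagonal α) w, Θ q' (((g * ⟨circleDiagonal 3 (fun k => ζ * Circle.exp (θ k)), circleDiagonal_mem_archLocal_diagonal L 3 α w _⟩ * g⁻¹ : archLocal L 3 (Matrix.diagonal α) w) : GL (Fin 3) ℂ) : Matrix (Fin 3) (Fin 3) ℂ) ∂ν) = fun q' => ∫ g, Ψ (y g, q') ∂ν := by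
    funext q'; exact integral_congr_ae (Eventually.of_forall fun g => (hΨy g q').symm)
  rw [hfun]
  exact key

/-! ## §2 The open class: `h1` and `h2` of ★ (E1)∕(E4′) for the central reader on `O ×ˢ T₂` -/

/-- **`h1` FOR THE OPEN CLASS**: `(q, θ) ↦ π(θ) • ∫_{G_w} Θ_q(↑↑(g·diag(ζe^{iθ})·g⁻¹)) dν` is `C^∞` on `O ×ˢ T₂`, `T₂ = (⋃_σ C_σ) ∩ B(0,½)`, for `Θ` with `ContDiffOn ℝ ∞ (uncurry Θ) (O ×ˢ univ)`
(`O` open) and one compact matrix support on `O` (★ p851244 `contDiffOn_rootProduct_smul_integral_param_chamber_ball_swap` for the localised global family on each chamber).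
[cite: HormanderALPDO1, Thm. 1.1.9, Thm. 1.4.1] [cite: Varadarajan1977, I §1.12] [cite: Rogawski1990, §8.4 p. 126] -/
theorem contDiffOn_centralReader_param_of_isOpen (hα : ∀ i, α i ≠ 0) (hreal : ∀ i, (w.1.embedding (α i)).im = 0)
    (ν : Measure (archLocal L 3 (Matrix.diagonal α) w)) [IsFiniteMeasureOnCompacts ν] (ζ : Circle)
    {O : Set Q} (hO : IsOpen O) (Θ : Q → Matrix (Fin 3) (Fin 3) ℂ → E) (hΘ : ContDiffOn ℝ ∞ (Function.uncurry Θ) (O ×ˢ (univ : Set (Matrix (Fin 3) (Fin 3) ℂ))))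
    (hΘc : ∃ C : Set (Matrix (Fin 3) (Fin 3) ℂ), IsCompact C ∧ ∀ q ∈ O, ∀ X : Matrix (Fin 3) (Fin 3) ℂ, X ∉ C → Θ q X = 0) :
    ContDiffOn ℝ ∞ (fun z : Q × (Fin 3 → ℝ) => (rootProduct z.2 : ℝ) • ∫ g : archLocal L 3 (Matrix.diagonal α) w, Θ z.1 (((g * ⟨circleDiagonal 3 (fun k => ζ * Circle.exp (z.2 k)), circleDiagonal_mem_archLocal_diagonal L 3 α w _⟩ * g⁻¹ : archLocal L 3 (Matrix.diagonal α) w) : GL (Fin 3) ℂ) : Matrix (Fin 3) (Fin 3) ℂ) ∂ν)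
      (O ×ˢ ({θ : Fin 3 → ℝ | ∃ σ : Equiv.Perm (Fin 3), θ (σ 0) < θ (σ 1) ∧ θ (σ 1) < θ (σ 2)} ∩ ball (0 : Fin 3 → ℝ) (1 / 2))) := by
  obtain ⟨C, hC, h0⟩ := hΘc
  have hCg : IsCompact {k : archLocal L 3 (Matrix.diagonal α) w | ((k : GL (Fin 3) ℂ) : Matrix (Fin 3) (Fin 3) ℂ) ∈ C} := isCompact_setOf_coe_archLocal_mem L 3 α w hα hC
  rintro ⟨q₀, θ₀⟩ ⟨hq₀, ⟨σ, hσ⟩, hball⟩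
  obtain ⟨Θ', hΘ', h0', hev⟩ := exists_contDiff_uncurry_eventuallyEq_of_contDiffOn hO hΘ h0 hq₀
  have hU : IsOpen ((univ : Set Q) ×ˢ ({θ : Fin 3 → ℝ | θ (σ 0) < θ (σ 1) ∧ θ (σ 1) < θ (σ 2)} ∩ ball (0 : Fin 3 → ℝ) (1 / 2))) := isOpen_univ.prod ((isOpen_chamber σ).inter isOpen_ball)
  have key := (contDiffOn_rootProduct_smul_integral_param_chamber_ball_swap L α w hα hreal ν (Function.uncurry Θ') hΘ' hCg
    (fun q k hk => h0' q _ hk) ζ σ).contDiffAt (x := (q₀, θ₀)) (hU.mem_nhds ⟨mem_univ _, hσ, hball⟩)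
  have hev' : (fun z : Q × (Fin 3 → ℝ) => (rootProduct z.2 : ℝ) • ∫ g : archLocal L 3 (Matrix.diagonal α) w, Θ z.1 (((g * ⟨circleDiagonal 3 (fun k => ζ * Circle.exp (z.2 k)), circleDiagonal_mem_archLocal_diagonal L 3 α w _⟩ * g⁻¹ : archLocal L 3 (Matrix.diagonal α) w) : GL (Fin 3) ℂ) : Matrix (Fin 3) (Fin 3) ℂ) ∂ν) =ᶠ[𝓝 (q₀, θ₀)]
      fun z : Q × (Fin 3 → ℝ) => (rootProduct z.2 : ℝ) • ∫ g : archLocal L 3 (Matrix.diagonal α) w, Function.uncurry Θ' (z.1, (((g * ⟨circleDiagonal 3 (fun k => ζ * Circle.exp (z.2 k)), circleDiagonal_mem_archLocal_diagonal L 3 α w _⟩ * g⁻¹ : archLocal L 3 (Matrix.diagonal α) w) : GL (Fin 3) ℂ) : Matrix (Fin 3) (Fin 3) ℂ)) ∂ν :=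
    ((continuous_fst.tendsto (q₀, θ₀)).eventually hev).mono fun z hz => by
      show (rootProduct z.2 : ℝ) • ∫ g : archLocal L 3 (Matrix.diagonal α) w, Θ z.1 _ ∂ν = (rootProduct z.2 : ℝ) • ∫ g : archLocal L 3 (Matrix.diagonal α) w, Θ' z.1 _ ∂ν
      rw [hz]
  exact (key.congr_of_eventuallyEq hev').contDiffWithinAt

omit [CompleteSpace E] in
/-- **`∂_v` INSIDE, OPEN CLASS**: for `q ∈ O` and `θ ∈ T₂`, `∂_v [q′ ↦ Φ_c(Θ_{q′})(θ)](q) = Φ_c(∂_v Θ_q)(θ)` (§1 for the localised family; `∂_v Θ′ = ∂_v Θ` near `q`).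
[cite: HormanderALPDO1, Thm. 1.1.9] [cite: Varadarajan1977, I §1.12] -/
theorem fderiv_centralReader_param_apply_of_mem_isOpen (hα : ∀ i, α i ≠ 0) (hreal : ∀ i, (w.1.embedding (α i)).im = 0)
    (ν : Measure (archLocal L 3 (Matrix.diagonal α) w)) [IsFiniteMeasureOnCompacts ν] (ζ : Circle)
    {O : Set Q} (hO : IsOpen O) (Θ : Q → Matrix (Fin 3) (Fin 3) ℂ → E) (hΘ : ContDiffOn ℝ ∞ (Function.uncurry Θ) (O ×ˢ (univ : Set (Matrix (Fin 3) (Fin 3) ℂ))))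
    (hΘc : ∃ C : Set (Matrix (Fin 3) (Fin 3) ℂ), IsCompact C ∧ ∀ q ∈ O, ∀ X : Matrix (Fin 3) (Fin 3) ℂ, X ∉ C → Θ q X = 0)
    {q : Q} (hq : q ∈ O) (v : Q) {θ : Fin 3 → ℝ} (hθ : θ ∈ ({θ : Fin 3 → ℝ | ∃ σ : Equiv.Perm (Fin 3), θ (σ 0) < θ (σ 1) ∧ θ (σ 1) < θ (σ 2)} ∩ ball (0 : Fin 3 → ℝ) (1 / 2))) :
    fderiv ℝ (fun q' : Q => (rootProduct θ : ℝ) • ∫ g : archLocal L 3 (Matrix.diagonal α) w, Θ q' (((g * ⟨circleDiagonal 3 (fun k => ζ * Circle.exp (θ k)), circleDiagonal_mem_archLocal_diagonal L 3 α w _⟩ * g⁻¹ : archLocal L 3 (Matrix.diagonal α) w) : GL (Fin 3) ℂ) : Matrix (Fin 3) (Fin 3) ℂ) ∂ν) q v =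
      (rootProduct θ : ℝ) • ∫ g : archLocal L 3 (Matrix.diagonal α) w, fderiv ℝ (fun q' : Q => Θ q' (((g * ⟨circleDiagonal 3 (fun k => ζ * Circle.exp (θ k)), circleDiagonal_mem_archLocal_diagonal L 3 α w _⟩ * g⁻¹ : archLocal L 3 (Matrix.diagonal α) w) : GL (Fin 3) ℂ) : Matrix (Fin 3) (Fin 3) ℂ)) q v ∂ν := by
  obtain ⟨C, hC, h0⟩ := hΘc
  obtain ⟨⟨σ, hσ⟩, hball⟩ := hθ
  have hreg : ∀ i j : Fin 3, i ≠ j → ζ * Circle.exp (θ i) ≠ ζ * Circle.exp (θ j) := fun i j hij => angleChart_ne_of_mem_chamber_ball ζ σ ⟨hσ, hball⟩ i j hij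
  obtain ⟨Θ', hΘ', h0', hev⟩ := exists_contDiff_uncurry_eventuallyEq_of_contDiffOn hO hΘ h0 hq
  have hev' : (fun q' : Q => (rootProduct θ : ℝ) • ∫ g : archLocal L 3 (Matrix.diagonal α) w, Θ q' (((g * ⟨circleDiagonal 3 (fun k => ζ * Circle.exp (θ k)), circleDiagonal_mem_archLocal_diagonal L 3 α w _⟩ * g⁻¹ : archLocal L 3 (Matrix.diagonal α) w) : GL (Fin 3) ℂ) : Matrix (Fin 3) (Fin 3) ℂ) ∂ν) =ᶠ[𝓝 q]
      fun q' : Q => (rootProduct θ : ℝ) • ∫ g : archLocal L 3 (Matrix.diagonal α) w, Θ' q' (((g * ⟨circleDiagonal 3 (fun k => ζ * Circle.exp (θ k)), circleDiagonal_mem_archLocal_diagonal L 3 α w _⟩ * g⁻¹ : archLocal L 3 (Matrix.diagonal α) w) : GL (Fin 3) ℂ) : Matrix (Fin 3) (Fin 3) ℂ) ∂ν := hev.mono fun q' hq' => by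
    show (rootProduct θ : ℝ) • ∫ g : archLocal L 3 (Matrix.diagonal α) w, Θ q' _ ∂ν = (rootProduct θ : ℝ) • ∫ g : archLocal L 3 (Matrix.diagonal α) w, Θ' q' _ ∂ν
    rw [hq']
  have hD : ∀ g : archLocal L 3 (Matrix.diagonal α) w, fderiv ℝ (fun q' : Q => Θ' q' (((g * ⟨circleDiagonal 3 (fun k => ζ * Circle.exp (θ k)), circleDiagonal_mem_archLocal_diagonal L 3 α w _⟩ * g⁻¹ : archLocal L 3 (Matrix.diagonal α) w) : GL (Fin 3) ℂ) : Matrix (Fin 3) (Fin 3) ℂ)) q v = fderiv ℝ (fun q' : Q => Θ q' (((g * ⟨circleDiagonal 3 (fun k => ζ * Circle.exp (θ k)), circleDiagonal_mem_archLocal_diagonal L 3 α w _⟩ * g⁻¹ : archLocal L 3 (Matrix.diagonal α) w) : GL (Fin 3) ℂ) : Matrix (Fin 3) (Fin 3) ℂ)) q v :=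
    fun g => by rw [Filter.EventuallyEq.fderiv_eq (hev.mono fun q' hq' => show Θ' q' _ = Θ q' _ by rw [hq'])]
  have hF := ((differentiableAt_integral_comp_conj_circleDiagonal_param L α w hα hreal ν Θ' hΘ' hC h0' ζ hreg q).hasFDerivAt.const_smul (rootProduct θ : ℝ)).fderiv
  have hpi : (fun q' : Q => (rootProduct θ : ℝ) • ∫ g : archLocal L 3 (Matrix.diagonal α) w, Θ' q' (((g * ⟨circleDiagonal 3 (fun k => ζ * Circle.exp (θ k)), circleDiagonal_mem_archLocal_diagonal L 3 α w _⟩ * g⁻¹ : archLocal L 3 (Matrix.diagonal α) w) : GL (Fin 3) ℂ) : Matrix (Fin 3) (Fin 3) ℂ) ∂ν) =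
      (rootProduct θ : ℝ) • fun q' : Q => ∫ g : archLocal L 3 (Matrix.diagonal α) w, Θ' q' (((g * ⟨circleDiagonal 3 (fun k => ζ * Circle.exp (θ k)), circleDiagonal_mem_archLocal_diagonal L 3 α w _⟩ * g⁻¹ : archLocal L 3 (Matrix.diagonal α) w) : GL (Fin 3) ℂ) : Matrix (Fin 3) (Fin 3) ℂ) ∂ν := rfl
  rw [hev'.fderiv_eq, hpi, hF]
  show (rootProduct θ : ℝ) • fderiv ℝ (fun q' : Q => ∫ g : archLocal L 3 (Matrix.diagonal α) w, Θ' q' (((g * ⟨circleDiagonal 3 (fun k => ζ * Circle.exp (θ k)), circleDiagonal_mem_archLocal_diagonal L 3 α w _⟩ * g⁻¹ : archLocal L 3 (Matrix.diagonal α) w) : GL (Fin 3) ℂ) : Matrix (Fin 3) (Fin 3) ℂ) ∂ν) q v = _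
  rw [fderiv_integral_comp_conj_circleDiagonal_param_apply L α w hα hreal ν Θ' hΘ' hC h0' ζ hreg q v]
  exact congrArg _ (integral_congr_ae (Eventually.of_forall hD))

/-- **`h2` FOR THE OPEN CLASS (joint `(v, 0)` form): at `x ∈ O ×ˢ T₂`, `D[(q,θ) ↦ Φ_c(Θ_q)(θ)](x)·(v, 0) = Φ_c(∂_v Θ_{x.1})(x.2)`** (★ `fderiv_slice_fst_apply_of_prod` + §2 `h1` for
differentiability + the pointwise `∂_v`). [cite: HormanderALPDO1, Thm. 1.1.9] [cite: Varadarajan1977, I §1.12] -/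
theorem fderiv_centralReader_param_prod_apply_of_isOpen (hα : ∀ i, α i ≠ 0) (hreal : ∀ i, (w.1.embedding (α i)).im = 0)
    (ν : Measure (archLocal L 3 (Matrix.diagonal α) w)) [IsFiniteMeasureOnCompacts ν] (ζ : Circle)
    {O : Set Q} (hO : IsOpen O) (Θ : Q → Matrix (Fin 3) (Fin 3) ℂ → E) (hΘ : ContDiffOn ℝ ∞ (Function.uncurry Θ) (O ×ˢ (univ : Set (Matrix (Fin 3) (Fin 3) ℂ))))
    (hΘc : ∃ C : Set (Matrix (Fin 3) (Fin 3) ℂ), IsCompact C ∧ ∀ q ∈ O, ∀ X : Matrix (Fin 3) (Fin 3) ℂ, X ∉ C → Θ q X = 0)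
    (v : Q) {x : Q × (Fin 3 → ℝ)} (hx : x ∈ O ×ˢ ({θ : Fin 3 → ℝ | ∃ σ : Equiv.Perm (Fin 3), θ (σ 0) < θ (σ 1) ∧ θ (σ 1) < θ (σ 2)} ∩ ball (0 : Fin 3 → ℝ) (1 / 2))) :
    fderiv ℝ (fun z : Q × (Fin 3 → ℝ) => (rootProduct z.2 : ℝ) • ∫ g : archLocal L 3 (Matrix.diagonal α) w, Θ z.1 (((g * ⟨circleDiagonal 3 (fun k => ζ * Circle.exp (z.2 k)), circleDiagonal_mem_archLocal_diagonal L 3 α w _⟩ * g⁻¹ : archLocal L 3 (Matrix.diagonal α) w) : GL (Fin 3) ℂ) : Matrix (Fin 3) (Fin 3) ℂ) ∂ν) x (v, (0 : Fin 3 → ℝ)) =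
      (rootProduct x.2 : ℝ) • ∫ g : archLocal L 3 (Matrix.diagonal α) w, fderiv ℝ (fun q' : Q => Θ q' (((g * ⟨circleDiagonal 3 (fun k => ζ * Circle.exp (x.2 k)), circleDiagonal_mem_archLocal_diagonal L 3 α w _⟩ * g⁻¹ : archLocal L 3 (Matrix.diagonal α) w) : GL (Fin 3) ℂ) : Matrix (Fin 3) (Fin 3) ℂ)) x.1 v ∂ν := by
  have hopen : IsOpen {θ : Fin 3 → ℝ | ∃ σ : Equiv.Perm (Fin 3), θ (σ 0) < θ (σ 1) ∧ θ (σ 1) < θ (σ 2)} := by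
    rw [Set.setOf_exists]; exact isOpen_iUnion fun σ => isOpen_chamber σ
  have hO' : IsOpen (O ×ˢ ({θ : Fin 3 → ℝ | ∃ σ : Equiv.Perm (Fin 3), θ (σ 0) < θ (σ 1) ∧ θ (σ 1) < θ (σ 2)} ∩ ball (0 : Fin 3 → ℝ) (1 / 2))) := hO.prod (hopen.inter isOpen_ball)
  have hd : DifferentiableAt ℝ (fun z : Q × (Fin 3 → ℝ) => (rootProduct z.2 : ℝ) • ∫ g : archLocal L 3 (Matrix.diagonal α) w, Θ z.1 (((g * ⟨circleDiagonal 3 (fun k => ζ * Circle.exp (z.2 k)), circleDiagonal_mem_archLocal_diagonal L 3 α w _⟩ * g⁻¹ : archLocal L 3 (Matrix.diagonal α) w) : GL (Fin 3) ℂ) : Matrix (Fin 3) (Fin 3) ℂ) ∂ν) x :=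
    ((contDiffOn_centralReader_param_of_isOpen L α w hα hreal ν ζ hO Θ hΘ hΘc).contDiffAt (hO'.mem_nhds hx)).differentiableAt (by simp)
  rw [← fderiv_slice_fst_apply_of_prod hd v]
  exact fderiv_centralReader_param_apply_of_mem_isOpen L α w hα hreal ν ζ hO Θ hΘ hΘc (Set.mem_prod.1 hx).1 v (Set.mem_prod.1 hx).2

/-! ## §3 The CLM-uniform bound `hunif` of the central reader on `T₂ ∩ B(0, ¼)` -/

/-- **`hunif` FOR THE CENTRAL READER**: for `G : M₃(ℂ) → E′` smooth with compact support there is ONE `B` with `‖Dⁿ[Φ_c(ℓ ∘ G)](θ)‖ ≤ ‖ℓ‖ · B` for every `θ ∈ T₂ ∩ B(0,¼)` and every CLM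
`ℓ : E′ →L E` (★ p851226 §6 on each of the six chambers, maxed; matrix support ⇒ group support by ★ `isCompact_setOf_coe_archLocal_mem`).  At `E′ := ℓ^∞(J, E)` this is the `hunif`
binder of ★ (E2)∕(E4′). [cite: WarnerHASSLG2, Thm. 8.4.3.1] [cite: Varadarajan1977, I §3] [cite: Bouaziz1994IntegralesOrbitales, §3.1 (I₁) p. 579] -/
theorem exists_forall_norm_iteratedFDeriv_centralReader_comp_clm_le (hα : ∀ i, α i ≠ 0) (hreal : ∀ i, (w.1.embedding (α i)).im = 0)
    (ν : Measure (archLocal L 3 (Matrix.diagonal α) w)) [ν.IsHaarMeasure] [ν.IsMulRightInvariant] (ζ : Circle)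
    {E' : Type*} [NormedAddCommGroup E'] [NormedSpace ℝ E'] [CompleteSpace E']
    (G : Matrix (Fin 3) (Fin 3) ℂ → E') (hG : ContDiff ℝ ∞ G) (hGc : HasCompactSupport G) (n : ℕ) :
    ∃ B : ℝ, ∀ θ ∈ ({θ : Fin 3 → ℝ | ∃ σ : Equiv.Perm (Fin 3), θ (σ 0) < θ (σ 1) ∧ θ (σ 1) < θ (σ 2)} ∩ ball (0 : Fin 3 → ℝ) (1 / 2)) ∩ ball (0 : Fin 3 → ℝ) (1 / 4), ∀ ℓ : E' →L[ℝ] E,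
      ‖iteratedFDeriv ℝ n (fun θ : Fin 3 → ℝ => (rootProduct θ : ℝ) • ∫ g : archLocal L 3 (Matrix.diagonal α) w, ℓ (G (((g * ⟨circleDiagonal 3 (fun k => ζ * Circle.exp (θ k)), circleDiagonal_mem_archLocal_diagonal L 3 α w _⟩ * g⁻¹ : archLocal L 3 (Matrix.diagonal α) w) : GL (Fin 3) ℂ) : Matrix (Fin 3) (Fin 3) ℂ)) ∂ν) θ‖ ≤ ‖ℓ‖ * B := by
  -- group support from matrix support
  have hGc' : HasCompactSupport fun k : archLocal L 3 (Matrix.diagonal α) w => G ((k : GL (Fin 3) ℂ) : Matrix (Fin 3) (Fin 3) ℂ) := by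
    refine HasCompactSupport.intro (isCompact_setOf_coe_archLocal_mem L 3 α w hα hGc) fun k hk => ?_
    exact image_eq_zero_of_notMem_tsupport hk
  -- one bound per chamber, then the max
  have hσ : ∀ σ : Equiv.Perm (Fin 3), ∃ M : ℝ, ∀ θ ∈ ({θ : Fin 3 → ℝ | θ (σ 0) < θ (σ 1) ∧ θ (σ 1) < θ (σ 2)} ∩ ball (0 : Fin 3 → ℝ) (1 / 4)), ∀ ℓ : E' →L[ℝ] E,
      ‖iteratedFDeriv ℝ n (fun θ : Fin 3 → ℝ => (rootProduct θ : ℝ) • ∫ g : archLocal L 3 (Matrix.diagonal α) w, ℓ (G (((g * ⟨circleDiagonal 3 (fun k => ζ * Circle.exp (θ k)), circleDiagonal_mem_archLocal_diagonal L 3 α w _⟩ * g⁻¹ : archLocal L 3 (Matrix.diagonal α) w) : GL (Fin 3) ℂ) : Matrix (Fin 3) (Fin 3) ℂ)) ∂ν) θ‖ ≤ ‖ℓ‖ * M :=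
    fun σ => exists_forall_norm_iteratedFDeriv_rootProduct_smul_orbital_comp_clm_le L α w hα hreal ν G hG hGc' ζ σ n
  choose M hM using hσ
  refine ⟨∑ σ, max (M σ) 0, fun θ hθ ℓ => ?_⟩
  obtain ⟨⟨⟨σ, hσθ⟩, -⟩, hball⟩ := hθ
  refine (hM σ θ ⟨hσθ, hball⟩ ℓ).trans (mul_le_mul_of_nonneg_left ?_ (norm_nonneg ℓ))
  exact (le_max_left _ _).trans (Finset.single_le_sum (f := fun τ => max (M τ) 0) (fun τ _ => le_max_right _ _) (Finset.mem_univ σ))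

end UnitaryGroup

end Literature.NumberTheory.Automorphic

end
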